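import Summits.Ventures.LatticeQCDFlow.Exactness.IMHSmithTierneyKernel
import Summits.Ventures.LatticeQCDFlow.Exactness.IMHRejectionCurveDeriv
import HarnessLib

/-!
# The Smith–Tierney recursion identities (I2) and (I1)

HONEST FRAMING: exact (Metropolis-corrected) sampling algorithms for lattice gauge theory;
figures of merit are autocorrelation/cost numbers at stated couplings and volumes; no
continuum-physics claim.  (SCALAR calibration rung S0-A: not a gauge result.)

Venture `LatticeQCDFlow` (cell pub-lqcd), topic `Exactness`; FANOUT row 2 (`s0-phi4`, FLOW arm).
NEW WORK of the cell (leg 3b of the Smith–Tierney kernel; nothing cited as a fact).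

## What is proved (`v > 0`; `P̃ = qMassLe`, `Π = massLe`, `λ = rejCurve`, `T_{n+1} = stKernel n`)

* `integral_rejCurve_pow_deriv` — FTC with RIGHT derivatives:
  `∫_c^a (n+1) λⁿ Π/u² = λ(a)^{n+1} − λ(c)^{n+1}`; **`stKernel_I2`** —
  `∫ 1[b ≤ a] (T_{n+1}(b ∨ c) − T_{n+1}(a)) w dμ = λ(a)^{n+1} − λ(c)^{n+1}` for `0 < c ≤ a` (Fubini
  over `[c, a)`, closed on the left so that the level mass is `Π(u)`, the right derivative of `λ`);
* `stTail_abs_le`, `integrableOn_stTail`, **`integral_Ioi_stTail`** — with `G(u) = λ(u)^{n+1}/u`: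
  `∫_{u>v} G'(u⁺) du = −G(v)` (FTC with right derivatives on `[v, M]`, `G(M) ≤ 1/M → 0`, and the
  improper limit `∫_v^M → ∫_{(v,∞)}`);
* **`stKernel_I1`** — `T_{n+2}(v) = T_{n+1}(v)·P̃(v) + ∫ 1[b > v] T_{n+1}(b) q dμ + λ(v)^{n+1}/v`:
  Fubini turns the middle term into `∫_{u>v} φₙ(u)(P̃(u) − P̃(v)) du`, `P̃ = λ + Π/u` splits
  `φₙ P̃` into `(n+2)λ^{n+1}/u² + G'`, and the tail term closes it.
-/

namespace Summit.Ventures.LatticeQCDFlow.Exactness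

open Real MeasureTheory Filter Set Topology intervalIntegral

variable {X : Type*} [MeasurableSpace X] {μ : Measure X} {w q : X → ℝ}

variable [SFinite μ]

/-! ## Identity (I2): `E_w[1(b ≤ a)(T(b ∨ c) − T(a))] = λ(a)^{n+1} − λ(c)^{n+1}` -/

/-- FTC for `λ^{n+1}` with right derivatives: `∫_c^a (n+1) λⁿ Π/u² = λ(a)^{n+1} − λ(c)^{n+1}`. -/
theorem integral_rejCurve_pow_deriv (hw0 : ∀ t, 0 < w t) (hwm : Measurable w) (hwi : Integrable w μ)
    (hq0 : ∀ t, 0 < q t) (hqm : Measurable q) (hqi : Integrable q μ) (hq1 : ∫ z, q z ∂μ = 1)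
    (n : ℕ) {c a : ℝ} (hc : 0 < c) (hca : c ≤ a) :
    ∫ u in c..a, ((n : ℝ) + 1) * rejCurve μ w q u ^ n * (massLe μ w q u / u ^ 2)
      = rejCurve μ w q a ^ (n + 1) - rejCurve μ w q c ^ (n + 1) := by
  refine integral_eq_sub_of_hasDeriv_right_of_le (f := fun u => rejCurve μ w q u ^ (n + 1)) hca ?_ ?_ ?_
  · exact ((continuousOn_rejCurve hw0 hwm hq0 hqm hqi hc).pow (n + 1))
  · intro u hu
    exact hasDerivWithinAt_rejCurve_pow hw0 hwm hwi hq0 hqm hqi (hc.trans hu.1) n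
  · -- bounded measurable integrand on `[c, a]`
    have hm : AEStronglyMeasurable (fun u => ((n : ℝ) + 1) * rejCurve μ w q u ^ n
        * (massLe μ w q u / u ^ 2)) (volume.restrict (uIoc c a)) :=
      ((measurable_const.mul ((measurable_rejCurve hwm hqm).pow_const n)).mul
        ((massLe_mono hw0 hwm hwi hqm).measurable.div (measurable_id.pow_const 2))).aestronglyMeasurable
    refine (intervalIntegrable_const (c := ((n : ℝ) + 1) * ((∫ z, w z ∂μ) / c ^ 2))).mono_fun' hm ?_
    refine (ae_restrict_iff' measurableSet_uIoc).2 (Eventually.of_forall fun u hu => ?_)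
    dsimp only
    rw [uIoc_of_le hca] at hu
    have hu0 : 0 < u := hc.trans hu.1
    obtain ⟨hl0, hl1⟩ := rejCurve_bounds hw0 hq0 hqi hu0 (μ := μ)
    rw [hq1] at hl1
    obtain ⟨hb0, hbl, hbZ⟩ := massBelow_bounds hw0 hwm hwi hqm u (q := q)
    have hL0 : 0 ≤ massLe μ w q u := hb0.trans hbl
    have hcp : c ^ 2 ≤ u ^ 2 := pow_le_pow_left₀ hc.le hu.1.le 2
    rw [Real.norm_eq_abs, abs_of_nonneg (mul_nonneg (mul_nonneg (by positivity) (pow_nonneg hl0 n))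
      (div_nonneg hL0 (sq_nonneg _)))]
    have h1 : rejCurve μ w q u ^ n ≤ 1 := pow_le_one₀ hl0 hl1
    have h2 : massLe μ w q u / u ^ 2 ≤ (∫ z, w z ∂μ) / c ^ 2 :=
      calc massLe μ w q u / u ^ 2 ≤ massLe μ w q u / c ^ 2 :=
            div_le_div_of_nonneg_left hL0 (pow_pos hc 2) hcp
        _ ≤ (∫ z, w z ∂μ) / c ^ 2 := div_le_div_of_nonneg_right hbZ (pow_pos hc 2).le
    calc ((n : ℝ) + 1) * rejCurve μ w q u ^ n * (massLe μ w q u / u ^ 2)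
        ≤ ((n : ℝ) + 1) * 1 * ((∫ z, w z ∂μ) / c ^ 2) :=
          mul_le_mul (mul_le_mul_of_nonneg_left h1 (by positivity)) h2
            (div_nonneg hL0 (sq_nonneg _)) (by positivity)
      _ = ((n : ℝ) + 1) * ((∫ z, w z ∂μ) / c ^ 2) := by ring

/-- **(I2)**: for `0 < c ≤ a`,
`∫ 1[b ≤ a] (T_{n+1}(b ∨ c) − T_{n+1}(a)) w dμ = λ(a)^{n+1} − λ(c)^{n+1}`
(Fubini on the difference formula, then the FTC above). -/
theorem stKernel_I2 (hw0 : ∀ t, 0 < w t) (hwm : Measurable w) (hwi : Integrable w μ)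
    (hq0 : ∀ t, 0 < q t) (hqm : Measurable q) (hqi : Integrable q μ) (hq1 : ∫ z, q z ∂μ = 1)
    (n : ℕ) {c a : ℝ} (hc : 0 < c) (hca : c ≤ a) :
    ∫ z, (if w z / q z ≤ a then
        (stKernel μ w q n (max (w z / q z) c) - stKernel μ w q n a) * w z else 0) ∂μ
      = rejCurve μ w q a ^ (n + 1) - rejCurve μ w q c ^ (n + 1) := by
  -- the layered integrand on `X × [c, a)`
  set φ : ℝ → ℝ := fun u => ((n : ℝ) + 1) * rejCurve μ w q u ^ n / u ^ 2 with hφ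
  have hφm : Measurable φ := measurable_stIntegrand hwm hqm n
  have hφb : ∀ u, c ≤ u → 0 ≤ φ u ∧ φ u ≤ ((n : ℝ) + 1) * (1 / c ^ 2) := by
    intro u hu
    obtain ⟨h0, h1⟩ := stIntegrand_bounds hw0 hq0 hqi hq1 n (hc.trans_le hu) (μ := μ)
    refine ⟨h0, h1.trans ?_⟩
    have hcp : c ^ 2 ≤ u ^ 2 := pow_le_pow_left₀ hc.le hu 2
    exact mul_le_mul_of_nonneg_left (div_le_div_of_nonneg_left zero_le_one (pow_pos hc 2) hcp)
      (by positivity)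
  -- pointwise: `1[b ≤ a](T(b∨c) − T(a)) w = ∫_{u ∈ [c,a)} 1[b ≤ u] w φ(u) du`
  have hpt : ∀ z, (if w z / q z ≤ a then
      (stKernel μ w q n (max (w z / q z) c) - stKernel μ w q n a) * w z else 0)
      = ∫ u in Ico c a, (if w z / q z ≤ u then w z * φ u else 0) := by
    intro z
    by_cases hz : w z / q z ≤ a
    · rw [if_pos hz]
      have hmax0 : 0 < max (w z / q z) c := lt_max_of_lt_right hc
      have hmaxa : max (w z / q z) c ≤ a := max_le hz hca
      rw [stKernel_sub_eq hw0 hwm hq0 hqm hqi hq1 n hmax0 hmaxa, ← MeasureTheory.integral_mul_const]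
      -- `∫_{Ico (b∨c) a} φ·w = ∫_{Ico c a} 1[b ≤ u] w φ`
      rw [← MeasureTheory.integral_indicator measurableSet_Ico,
        ← MeasureTheory.integral_indicator measurableSet_Ico]
      refine integral_congr_ae (Eventually.of_forall fun u => ?_)
      simp only [Set.indicator_apply, Set.mem_Ico]
      by_cases hu : c ≤ u ∧ u < a
      · rw [if_pos hu]
        by_cases hb : w z / q z ≤ u
        · rw [if_pos ⟨max_le hb hu.1, hu.2⟩, if_pos hb, mul_comm]
        · rw [if_neg hb, if_neg (fun h => hb ((le_max_left _ _).trans h.1))]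
      · rw [if_neg hu, if_neg (fun h => hu ⟨(le_max_right _ _).trans h.1, h.2⟩)]
    · rw [if_neg hz]
      symm
      rw [setIntegral_congr_fun measurableSet_Ico (g := fun _ => (0 : ℝ))
        (fun u hu => if_neg (fun h => hz (h.trans hu.2.le))), integral_zero]
  simp_rw [hpt]
  -- Fubini (in the order `(u, z)`)
  have hF : Integrable (Function.uncurry fun (u : ℝ) (z : X) =>
      (if w z / q z ≤ u then w z * φ u else 0 : ℝ)) ((volume.restrict (Ico c a)).prod μ) := by
    have hmeas : Measurable (Function.uncurry fun (u : ℝ) (z : X) =>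
        (if w z / q z ≤ u then w z * φ u else 0 : ℝ)) :=
      Measurable.ite (measurableSet_le ((hwm.div hqm).comp measurable_snd) measurable_fst)
        ((hwm.comp measurable_snd).mul (hφm.comp measurable_fst)) measurable_const
    have hG : Integrable (fun p : ℝ × X => (((n : ℝ) + 1) * (1 / c ^ 2)) * w p.2)
        ((volume.restrict (Ico c a)).prod μ) :=
      (integrable_const _).mul_prod hwi
    refine Integrable.mono' hG hmeas.aestronglyMeasurable ?_
    rw [Measure.restrict_prod_eq_prod_univ,
      ae_restrict_iff' (measurableSet_Ico.prod MeasurableSet.univ)]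
    refine Eventually.of_forall fun p hp => ?_
    obtain ⟨hu, -⟩ := hp
    obtain ⟨hφ0, hφ1⟩ := hφb p.1 hu.1
    show ‖(if w p.2 / q p.2 ≤ p.1 then w p.2 * φ p.1 else 0 : ℝ)‖ ≤ ((n : ℝ) + 1) * (1 / c ^ 2) * w p.2
    rw [Real.norm_eq_abs]
    split_ifs
    · rw [abs_of_nonneg (mul_nonneg (hw0 _).le hφ0), mul_comm]
      exact mul_le_mul_of_nonneg_right hφ1 (hw0 _).le
    · rw [abs_zero]
      exact mul_nonneg (by positivity) (hw0 _).le
  rw [← integral_integral_swap hF]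
  -- inner integral: `∫ 1[b ≤ u] w φ(u) dμ = Π(u) φ(u)`
  have hinner : ∀ u, ∫ z, (if w z / q z ≤ u then w z * φ u else 0) ∂μ = massLe μ w q u * φ u := by
    intro u
    unfold massLe
    rw [← MeasureTheory.integral_mul_const]
    refine integral_congr_ae (Eventually.of_forall fun z => ?_)
    show (if w z / q z ≤ u then w z * φ u else 0 : ℝ) = (if w z / q z ≤ u then w z else 0) * φ u
    split_ifs
    · rfl
    · exact (zero_mul _).symm
  simp_rw [hinner]
  -- `∫_{[c,a)} Π φ = ∫_c^a (n+1) λⁿ Π/u²`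
  rw [integral_Ico_eq_integral_Ioo, ← integral_Ioc_eq_integral_Ioo, ← intervalIntegral.integral_of_le hca,
    ← integral_rejCurve_pow_deriv hw0 hwm hwi hq0 hqm hqi hq1 n hc hca]
  refine intervalIntegral.integral_congr_ae (Eventually.of_forall fun u _ => ?_)
  simp only [hφ]
  ring

/-! ## Identity (I1): the recursion -/

omit [SFinite μ] in
/-- Pointwise bound on the tail integrand `G'(u) = (n+1)λⁿΠ(u)/u³ − λ^{n+1}/u²`:
`|G'(u)| ≤ (n+1) Z/u³ + 1/u²` (`u > 0`). -/
theorem stTail_abs_le (hw0 : ∀ t, 0 < w t) (hwm : Measurable w) (hwi : Integrable w μ)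
    (hq0 : ∀ t, 0 < q t) (hqm : Measurable q) (hqi : Integrable q μ) (hq1 : ∫ z, q z ∂μ = 1)
    (n : ℕ) {u : ℝ} (hu : 0 < u) :
    |((n : ℝ) + 1) * rejCurve μ w q u ^ n * (massLe μ w q u / u ^ 2) * u⁻¹
        + rejCurve μ w q u ^ (n + 1) * (-(u ^ 2)⁻¹)|
      ≤ ((n : ℝ) + 1) * (∫ z, w z ∂μ) * (1 / u ^ 3) + 1 / u ^ 2 := by
  obtain ⟨hl0, hl1⟩ := rejCurve_bounds hw0 hq0 hqi hu (μ := μ)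
  rw [hq1] at hl1
  obtain ⟨hb0, hbl, hbZ⟩ := massBelow_bounds hw0 hwm hwi hqm u (q := q)
  have hL0 : 0 ≤ massLe μ w q u := hb0.trans hbl
  have hp : rejCurve μ w q u ^ n ≤ 1 := pow_le_one₀ hl0 hl1
  have hp1 : rejCurve μ w q u ^ (n + 1) ≤ 1 := pow_le_one₀ hl0 hl1
  refine (abs_add_le _ _).trans (add_le_add ?_ ?_)
  · rw [abs_of_nonneg (by positivity)]
    have e : ((n : ℝ) + 1) * rejCurve μ w q u ^ n * (massLe μ w q u / u ^ 2) * u⁻¹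
        = ((n : ℝ) + 1) * (rejCurve μ w q u ^ n * massLe μ w q u) * (1 / u ^ 3) := by
      field_simp
    rw [e]
    refine mul_le_mul_of_nonneg_right (mul_le_mul_of_nonneg_left ?_ (by positivity))
      (by positivity)
    calc rejCurve μ w q u ^ n * massLe μ w q u ≤ 1 * massLe μ w q u :=
          mul_le_mul_of_nonneg_right hp hL0
      _ ≤ ∫ z, w z ∂μ := by rw [one_mul]; exact hbZ
  · rw [mul_neg, abs_neg, abs_of_nonneg (mul_nonneg (pow_nonneg hl0 _) (inv_nonneg.2 (sq_nonneg _))),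
      one_div]
    exact mul_le_of_le_one_left (inv_nonneg.2 (sq_nonneg _)) hp1

/-- The tail integrand is integrable on `(v, ∞)`, `v > 0`. -/
theorem integrableOn_stTail (hw0 : ∀ t, 0 < w t) (hwm : Measurable w) (hwi : Integrable w μ)
    (hq0 : ∀ t, 0 < q t) (hqm : Measurable q) (hqi : Integrable q μ) (hq1 : ∫ z, q z ∂μ = 1)
    (n : ℕ) {v : ℝ} (hv : 0 < v) :
    IntegrableOn (fun u : ℝ => ((n : ℝ) + 1) * rejCurve μ w q u ^ n * (massLe μ w q u / u ^ 2) * u⁻¹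
        + rejCurve μ w q u ^ (n + 1) * (-(u ^ 2)⁻¹)) (Ioi v) := by
  have hr := measurable_rejCurve (μ := μ) hwm hqm
  have hm := (massLe_mono hw0 hwm hwi hqm).measurable
  have hG'm : Measurable (fun u : ℝ => ((n : ℝ) + 1) * rejCurve μ w q u ^ n
      * (massLe μ w q u / u ^ 2) * u⁻¹ + rejCurve μ w q u ^ (n + 1) * (-(u ^ 2)⁻¹)) :=
    (((measurable_const.mul (hr.pow_const n)).mul (hm.div (measurable_id.pow_const 2))).mul
      measurable_id.inv).add ((hr.pow_const (n + 1)).mul (measurable_id.pow_const 2).inv.neg)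
  have hB : IntegrableOn (fun u : ℝ => ((n : ℝ) + 1) * (∫ z, w z ∂μ) * (1 / u ^ 3) + 1 / u ^ 2)
      (Ioi v) := ((integrableOn_one_div_pow_Ioi hv (by norm_num : 2 ≤ 3)).const_mul _).add (integrableOn_one_div_pow_Ioi hv (le_refl 2))
  refine Integrable.mono' hB hG'm.aestronglyMeasurable ?_
  refine (ae_restrict_iff' measurableSet_Ioi).2 (Eventually.of_forall fun u hu => ?_)
  rw [Real.norm_eq_abs]
  exact stTail_abs_le hw0 hwm hwi hq0 hqm hqi hq1 n (hv.trans hu)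

/-- **The tail term.**  With `G(u) = λ(u)^{n+1}/u`: `∫_{u>v} G'(u⁺) du = −G(v)` (`G(M) → 0`). -/
theorem integral_Ioi_stTail (hw0 : ∀ t, 0 < w t) (hwm : Measurable w)
    (hwi : Integrable w μ) (hq0 : ∀ t, 0 < q t) (hqm : Measurable q) (hqi : Integrable q μ)
    (hq1 : ∫ z, q z ∂μ = 1) (n : ℕ) {v : ℝ} (hv : 0 < v) :
    ∫ u in Ioi v, (((n : ℝ) + 1) * rejCurve μ w q u ^ n * (massLe μ w q u / u ^ 2) * u⁻¹
        + rejCurve μ w q u ^ (n + 1) * (-(u ^ 2)⁻¹))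
      = -(rejCurve μ w q v ^ (n + 1) / v) := by
  set G : ℝ → ℝ := fun u => rejCurve μ w q u ^ (n + 1) / u with hG
  set G' : ℝ → ℝ := fun u => ((n : ℝ) + 1) * rejCurve μ w q u ^ n * (massLe μ w q u / u ^ 2) * u⁻¹
    + rejCurve μ w q u ^ (n + 1) * (-(u ^ 2)⁻¹) with hG'
  have hlam : ∀ u, 0 < u → 0 ≤ rejCurve μ w q u ∧ rejCurve μ w q u ≤ 1 := fun u hu => by
    obtain ⟨h0, h1⟩ := rejCurve_bounds hw0 hq0 hqi hu (μ := μ)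
    rw [hq1] at h1
    exact ⟨h0, h1⟩
  have hint : IntegrableOn G' (Ioi v) := integrableOn_stTail hw0 hwm hwi hq0 hqm hqi hq1 n hv
  -- FTC on `[v, M]`
  have hcontG : ∀ M, ContinuousOn G (Icc v M) := by
    intro M
    refine ContinuousOn.div ((continuousOn_rejCurve hw0 hwm hq0 hqm hqi hv).pow (n + 1))
      continuousOn_id fun u hu => (hv.trans_le hu.1).ne'
  have hFTC : ∀ M, v ≤ M → ∫ u in v..M, G' u = G M - G v := by
    intro M hM
    refine integral_eq_sub_of_hasDeriv_right_of_le (f := G) hM (hcontG M) (fun u hu => ?_)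
      ((intervalIntegrable_iff_integrableOn_Ioc_of_le hM).2 (hint.mono_set Ioc_subset_Ioi_self))
    exact hasDerivWithinAt_rejCurve_pow_div hw0 hwm hwi hq0 hqm hqi (hv.trans hu.1) n
  -- limits as `M → ∞`
  have h1 : Tendsto (fun M => ∫ u in v..M, G' u) atTop (𝓝 (∫ u in Ioi v, G' u)) :=
    intervalIntegral_tendsto_integral_Ioi v hint tendsto_id
  have hGto : Tendsto G atTop (𝓝 0) := by
    have hup : ∀ᶠ M in atTop, G M ≤ M⁻¹ := by
      filter_upwards [eventually_gt_atTop 0] with M hM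
      obtain ⟨hl0, hl1⟩ := hlam M hM
      show rejCurve μ w q M ^ (n + 1) / M ≤ M⁻¹
      rw [div_eq_mul_inv]
      exact mul_le_of_le_one_left (inv_nonneg.2 hM.le) (pow_le_one₀ hl0 hl1)
    have hlo : ∀ᶠ M in atTop, 0 ≤ G M := by
      filter_upwards [eventually_gt_atTop 0] with M hM
      obtain ⟨hl0, -⟩ := hlam M hM
      exact div_nonneg (pow_nonneg hl0 _) hM.le
    exact tendsto_of_tendsto_of_tendsto_of_le_of_le' tendsto_const_nhds tendsto_inv_atTop_zero hlo hup
  have h2 : Tendsto (fun M => ∫ u in v..M, G' u) atTop (𝓝 (0 - G v)) := by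
    refine (hGto.sub_const (G v)).congr' ?_
    filter_upwards [eventually_ge_atTop v] with M hM
    exact (hFTC M hM).symm
  have h := tendsto_nhds_unique h1 h2
  rw [h, zero_sub]

/-- **THE SMITH–TIERNEY RECURSION (I1)**: for every `v > 0`,
`T_{n+2}(v) = T_{n+1}(v)·P̃(v) + ∫ 1[b > v] T_{n+1}(b) q dμ + λ(v)^{n+1}/v`. -/
theorem stKernel_I1 (hw0 : ∀ t, 0 < w t) (hwm : Measurable w) (hwi : Integrable w μ)
    (hq0 : ∀ t, 0 < q t) (hqm : Measurable q) (hqi : Integrable q μ) (hq1 : ∫ z, q z ∂μ = 1)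
    (n : ℕ) {v : ℝ} (hv : 0 < v) :
    stKernel μ w q (n + 1) v
      = stKernel μ w q n v * qMassLe μ w q v
        + ∫ z, (if v < w z / q z then stKernel μ w q n (w z / q z) * q z else 0) ∂μ
        + rejCurve μ w q v ^ (n + 1) / v := by
  set φ : ℝ → ℝ := fun u => ((n : ℝ) + 1) * rejCurve μ w q u ^ n / u ^ 2 with hφ
  have hφm : Measurable φ := measurable_stIntegrand hwm hqm n
  have hφi : IntegrableOn φ (Ioi v) := integrableOn_stIntegrand hw0 hwm hq0 hqm hqi hq1 n hv
  have hφb : ∀ u, v < u → 0 ≤ φ u ∧ φ u ≤ ((n : ℝ) + 1) * (1 / u ^ 2) := fun u hu =>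
    stIntegrand_bounds hw0 hq0 hqi hq1 n (hv.trans hu)
  -- Step 1: the `E_q` term by Fubini
  have hE : ∫ z, (if v < w z / q z then stKernel μ w q n (w z / q z) * q z else 0) ∂μ
      = ∫ u in Ioi v, φ u * (qMassLe μ w q u - qMassLe μ w q v) := by
    -- pointwise in `z`
    have hpt : ∀ z, (if v < w z / q z then stKernel μ w q n (w z / q z) * q z else 0)
        = ∫ u in Ioi v, (if v < w z / q z ∧ w z / q z ≤ u then φ u * q z else 0) := by
      intro z
      by_cases hz : v < w z / q z
      · rw [if_pos hz]
        unfold stKernel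
        rw [← integral_Ici_eq_integral_Ioi, ← MeasureTheory.integral_mul_const,
          ← MeasureTheory.integral_indicator measurableSet_Ici,
          ← MeasureTheory.integral_indicator measurableSet_Ioi]
        refine integral_congr_ae (Eventually.of_forall fun u => ?_)
        simp only [Set.indicator_apply, Set.mem_Ici, Set.mem_Ioi]
        by_cases hu : w z / q z ≤ u
        · rw [if_pos hu, if_pos (hz.trans_le hu), if_pos ⟨hz, hu⟩]
        · rw [if_neg hu]
          split_ifs with h1 h2
          · exact absurd h2.2 hu
          · rfl
          · rfl
      · rw [if_neg hz]
        symm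
        rw [setIntegral_congr_fun measurableSet_Ioi (g := fun _ => (0 : ℝ))
          (fun u _ => if_neg (fun h => hz h.1)), integral_zero]
    simp_rw [hpt]
    -- Fubini in the order `(u, z)`
    have hF : Integrable (Function.uncurry fun (u : ℝ) (z : X) =>
        (if v < w z / q z ∧ w z / q z ≤ u then φ u * q z else 0 : ℝ))
        ((volume.restrict (Ioi v)).prod μ) := by
      have hmeas : Measurable (Function.uncurry fun (u : ℝ) (z : X) =>
          (if v < w z / q z ∧ w z / q z ≤ u then φ u * q z else 0 : ℝ)) :=
        Measurable.ite ((measurableSet_lt measurable_const ((hwm.div hqm).comp measurable_snd)).inter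
          (measurableSet_le ((hwm.div hqm).comp measurable_snd) measurable_fst))
          ((hφm.comp measurable_fst).mul (hqm.comp measurable_snd)) measurable_const
      have hG : Integrable (fun p : ℝ × X => (((n : ℝ) + 1) * (1 / p.1 ^ 2)) * q p.2)
          ((volume.restrict (Ioi v)).prod μ) :=
        ((integrableOn_one_div_pow_Ioi hv (le_refl 2)).const_mul _).mul_prod hqi
      refine Integrable.mono' hG hmeas.aestronglyMeasurable ?_
      rw [Measure.restrict_prod_eq_prod_univ,
        ae_restrict_iff' (measurableSet_Ioi.prod MeasurableSet.univ)]
      refine Eventually.of_forall fun p hp => ?_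
      obtain ⟨hu, -⟩ := hp
      obtain ⟨hφ0, hφ1⟩ := hφb p.1 hu
      show ‖(if v < w p.2 / q p.2 ∧ w p.2 / q p.2 ≤ p.1 then φ p.1 * q p.2 else 0 : ℝ)‖
        ≤ ((n : ℝ) + 1) * (1 / p.1 ^ 2) * q p.2
      rw [Real.norm_eq_abs]
      split_ifs
      · rw [abs_of_nonneg (mul_nonneg hφ0 (hq0 _).le)]
        exact mul_le_mul_of_nonneg_right hφ1 (hq0 _).le
      · rw [abs_zero]
        exact mul_nonneg (mul_nonneg (by positivity) (by positivity)) (hq0 _).le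
    rw [← integral_integral_swap hF]
    refine setIntegral_congr_fun measurableSet_Ioi fun u hu => ?_
    show ∫ z, (if v < w z / q z ∧ w z / q z ≤ u then φ u * q z else 0) ∂μ
      = φ u * (qMassLe μ w q u - qMassLe μ w q v)
    rw [qMassLe_sub hwm hq0 hqm hqi (le_of_lt hu), ← MeasureTheory.integral_const_mul]
    refine integral_congr_ae (Eventually.of_forall fun z => ?_)
    show (if v < w z / q z ∧ w z / q z ≤ u then φ u * q z else 0 : ℝ)
      = φ u * (if v < w z / q z ∧ w z / q z ≤ u then q z else 0)
    split_ifs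
    · rfl
    · exact (mul_zero _).symm
  -- Step 2–3: `T(v) P̃(v) + E = ∫_{u>v} φ(u) P̃(u) du`
  have hPm : Measurable (qMassLe μ w q) := (qMassLe_mono hwm hq0 hqm hqi).measurable
  have hPb : ∀ u, 0 ≤ qMassLe μ w q u ∧ qMassLe μ w q u ≤ 1 := fun u => by
    obtain ⟨h0, h1⟩ := qMassLe_bounds hwm hq0 hqm hqi u (μ := μ)
    rw [hq1] at h1
    exact ⟨h0, h1⟩
  have hφP : IntegrableOn (fun u => φ u * qMassLe μ w q u) (Ioi v) := by
    refine Integrable.mono' hφi (hφm.mul hPm).aestronglyMeasurable ?_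
    refine (ae_restrict_iff' measurableSet_Ioi).2 (Eventually.of_forall fun u hu => ?_)
    obtain ⟨hφ0, -⟩ := hφb u hu
    rw [Real.norm_eq_abs, abs_of_nonneg (mul_nonneg hφ0 (hPb u).1)]
    exact mul_le_of_le_one_right hφ0 (hPb u).2
  have hsum : stKernel μ w q n v * qMassLe μ w q v
      + ∫ z, (if v < w z / q z then stKernel μ w q n (w z / q z) * q z else 0) ∂μ
      = ∫ u in Ioi v, φ u * qMassLe μ w q u := by
    rw [hE]
    have e1 : stKernel μ w q n v * qMassLe μ w q v = ∫ u in Ioi v, φ u * qMassLe μ w q v := by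
      unfold stKernel
      rw [← MeasureTheory.integral_mul_const]
    have hI2 : Integrable (fun u => φ u * (qMassLe μ w q u - qMassLe μ w q v))
        (volume.restrict (Ioi v)) := by
      refine (hφP.sub (hφi.mul_const (qMassLe μ w q v))).congr (Eventually.of_forall fun u => ?_)
      simp only [Pi.sub_apply]
      ring
    rw [e1, ← integral_add (hφi.mul_const _) hI2]
    refine integral_congr_ae (Eventually.of_forall fun u => ?_)
    ring
  -- Step 4–5: `∫ φ P̃ = T_{n+2}(v) + ∫ G' = T_{n+2}(v) − λ(v)^{n+1}/v`
  have htail := integral_Ioi_stTail hw0 hwm hwi hq0 hqm hqi hq1 n hv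
  set G' : ℝ → ℝ := fun u => ((n : ℝ) + 1) * rejCurve μ w q u ^ n * (massLe μ w q u / u ^ 2) * u⁻¹
    + rejCurve μ w q u ^ (n + 1) * (-(u ^ 2)⁻¹) with hG'
  have hG'i : IntegrableOn G' (Ioi v) := integrableOn_stTail hw0 hwm hwi hq0 hqm hqi hq1 n hv
  have hφi' : IntegrableOn (fun u : ℝ => (((n + 1 : ℕ) : ℝ) + 1) * rejCurve μ w q u ^ (n + 1) / u ^ 2)
      (Ioi v) := integrableOn_stIntegrand hw0 hwm hq0 hqm hqi hq1 (n + 1) hv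
  have hsplit : ∫ u in Ioi v, φ u * qMassLe μ w q u
      = (∫ u in Ioi v, (((n + 1 : ℕ) : ℝ) + 1) * rejCurve μ w q u ^ (n + 1) / u ^ 2)
        + ∫ u in Ioi v, G' u := by
    rw [← integral_add hφi' hG'i]
    refine setIntegral_congr_fun measurableSet_Ioi fun u hu => ?_
    have hu0 : 0 < u := hv.trans hu
    have hune : u ≠ 0 := hu0.ne'
    show φ u * qMassLe μ w q u = _
    have hP : qMassLe μ w q u = rejCurve μ w q u + massLe μ w q u / u := by
      rw [rejCurve_eq_qMassLe_sub hw0 hwm hwi hq0 hqm hqi hu0]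
      ring
    rw [hP]
    simp only [hφ, hG', Nat.cast_add, Nat.cast_one]
    field_simp
    ring
  rw [hsum, hsplit, htail]
  unfold stKernel
  ring

end Summit.Ventures.LatticeQCDFlow.Exactness
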